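import Mathlib
import HarnessLib
import Summits.Ventures.LatticeQCDFlow.Statement
import Summits.Ventures.LatticeQCDFlow.Scaling.BarriersTunnelling
import Summits.Ventures.LatticeQCDFlow.Scaling.BarriersIntrinsicTunnelling
import Summits.Ventures.LatticeQCDFlow.Scaling.BarriersBlockTunnelling
import Summits.Ventures.LatticeQCDFlow.Scaling.FluxTunnellingU1AllVolumes
import Summits.Ventures.LatticeQCDFlow.Scaling.FluxTunnellingU1AutocorrelationAll
import Summits.Ventures.LatticeQCDFlow.Scaling.ThinSectorsConnected
import Summits.Ventures.LatticeQCDFlow.Scaling.FluxInsertionHeightLaw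
import Summits.Ventures.LatticeQCDFlow.Scaling.FluxInsertionHeightValue
import Summits.Ventures.LatticeQCDFlow.Scaling.FluxInsertionLineHeightValueFour

/-!
# Venture statement — LatticeQCDFlow — DRAFT, Part S4–S8: TOPOLOGICAL FREEZING OF EXACT LOCAL
# SAMPLERS AS THEOREMS (theory-2's tunnelling / sector programme, rows 29–30)

HONEST FRAMING: exact (Metropolis-corrected) sampling algorithms for lattice gauge theory;
figures of merit are autocorrelation/cost numbers at stated couplings and volumes; no
continuum-physics claim.

This file CONTINUES the venture's `Statement.lean` DRAFT (review-queued; it STAYS A DRAFT until the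
operator adopts it) on the theory-2 side, as `StatementStaircase.lean` / `StatementSharp.lean`
(Parts T10–T18) do on the theory-1 side.  `Statement.lean` Part S typed the volume barrier (S1, B1),
the relaxation time (S2) and the sector mixing floor of INDEPENDENCE samplers (S3′).  Rows 29/30
(theory2 / lean-1, THEORY-2.md §3.3, §4 C7–C9″, §5.12–5.21) have since made the complementary
statement — TOPOLOGICAL FREEZING OF EXACT *LOCAL* SAMPLERS — a family of theorems in the tree; this
part states them as `Prop`s over the landed substrate, each with its `_holds` discharge, and proves
`TheoryStatementS8 := TheoryStatement ∧ S4 ∧ S5 ∧ S6 ∧ S7 ∧ S8`.  It is a separate module only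
because of the tree's 400-line limit.

* **S4 (THE LOCAL-MOVE TUNNELLING LAWS — charge, intrinsic and block forms)** —
  `Barriers.LocalMoveTunnellingLaw ∧ Barriers.IntrinsicTunnellingLaw ∧ Barriers.BlockTunnellingLaw`
  (`Scaling/Barriers{Tunnelling, IntrinsicTunnelling, BlockTunnelling}.lean`, all three closed
  `Prop`s DISCHARGED in the tree): for every `μ`-invariant Markov kernel whose moves are a.s.
  "allowed" and every set `B` separating a charge along allowed moves, `(μ ⊗ κ){Q ≠ Q'} ≤ 2·μ(B)`;
  instances: `ρ`-small steps of compact `U(1)` (collar `4ρ`), plaquette-local and link-local patches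
  at the SHARP patch-action threshold `#P(1 − cos(π/#P))`, `n`-step union bound; the charge-free
  `SU(N)` / `U(N)` forms with sectors := connected components of the admissible region (single-link,
  exposed and slab updates), and the gauge-fixed solid-block form.  Value-free reading: an exact
  sampler that updates few links per step changes the topological sector per step at most twice the
  invariant law's mass of ONE thick plaquette (resp. of a thin collar).
* **S5 (THE EXPLICIT `d = 2` `U(1)` SINGLE-LINK LAW, every volume)** — for every `L ≥ 2`, `β ≥ 0`,
  base point, link `e₀` and every Markov kernel leaving the Wilson measure `μ_{β,L}` invariant whose
  steps change only `e₀`: `c_β·z₁(β)³·(μ_{β,L} ⊗ κ){Q ≠ Q'} ≤ 2e^{−2β}` with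
  `c_β = e^{−3/2}/(π·max(1,β))` (`TwoDim.u1_tunnelling_single_link_all`, lean-1 GEN-5; even `L`:
  `c = 1`, `TwoDim.u1_tunnelling_single_link`) — theory-2's Gibbs-tail hypotheses discharged in
  `d = 2` with explicit constants.
* **S6 (THE SECTOR AUTOCOVARIANCE FLOOR)** — for ANY process `Z_k` with one-time marginals `μ_{β,L}`
  and one-link steps (every exact local sampler in equilibrium, reversible or not) and any set `S` of
  charges with `P{Q(Z_0) ∈ S} = P{Q(Z_n) ∈ S} = a`:
  `Cov(1_S(Q Z_0), 1_S(Q Z_n)) ≥ a(1 − a) − n·2e^{−2β}/(c_β z₁(β)³)`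
  (`TwoDim.u1_sector_autocov_floor_all`) — topological freezing of local updates with constants.
* **S7 (THE `ε`-SECTORS ARE THE FLUX SECTORS, `d = 2` — conjecture C8 PROVED)** — for every `L ≥ 1`
  and every `ε`, two `ε`-thin configurations with the same flux charge lie in one connected component
  of the thin set (`ThinSectors.ThinComponentsEqFluxSectors`, theory2 item 110): the metric and the
  topological obstruction coincide.
* **S8 (WHAT AN EXACT INSERTION MOVE COSTS, EXACTLY — conjectures C9″b / C9″c DECIDED)** — for
  gen-19's exact two-sided Metropolis flux-insertion kernels on the 2-d `U(1)` torus: (i) the block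
  kernel's essential min–max height `E(l,L)` obeys the fixed-volume Laplace law
  `e^{−β(E+ε)} ≤ P_{β,l,L} ≤ e^{−β(E−ε)}` eventually in `β` and has the TWO-REGIME closed form
  `E(l,L) = N(1 − cos(π/N)) + M(1 − cos(π/M))` if `2N ≤ L²`, `= L²(1 − cos(2π/L²))` otherwise
  (`N = (l+1)² − 4`, `M = L² − N`; `2 ≤ l`, `l + 1 ≤ L`, every parity; `Flux.boxHeight_toReal_eq_ite`,
  `Flux.u1_boxInsertion_height_law`, lean-1 GEN-6 / theory2 item 106b); (ii) the LINE kernel's height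
  equals `L(1 − cos(π/L)) + (L² − L)(1 − cos(π/(L² − L)))` and is its fixed-volume rate for EVERY
  `L ≥ 4` (`Flux.lineHeight_eq_sharp_four`, `Flux.u1_lineInsertion_fixedVolume_rate_four`, lean-1
  GEN-7) — C9″c exactly as conjectured.

NOT part of the binding text: any tunnelling rate, autocorrelation time or acceptance of a concrete
sampler at a concrete `(β, L)` beyond what the tree proves; the Gibbs tails entering S4 as
hypotheses for `SU(N)`; `L = 3` for the line kernel; prefactors of the Laplace laws; anything about
non-abelian insertion moves or `d > 2` insertion kernels (the `d ≥ 3` SECTOR theorem C10 and the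
HMC law are Part S9–S10, appended in `StatementSectors.lean` when their files land).
-/

noncomputable section

namespace Summit.Ventures.LatticeQCDFlow

open MeasureTheory ProbabilityTheory Filter
open scoped ENNReal
open Literature.MathematicalPhysics.QuantumFieldTheory Literature.MathematicalPhysics.QuantumLattice
open Summit.Ventures.LatticeQCDFlow.Theory2.Lattice
open Summit.Ventures.LatticeQCDFlow.Theory2.Lattice.Flux

/-! ### Part S, continued — topological freezing of exact LOCAL samplers -/

/-- **S4 (THE LOCAL-MOVE TUNNELLING LAWS).**  The conjunction of the three catalogued, DISCHARGED
barrier entries `Barriers.LocalMoveTunnellingLaw` (v3.0: abstract two-line law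
`(μ ⊗ κ){Q ≠ Q'} ≤ 2μ(B)` for a separating set `B`, + the compact-`U(1)` small-step / sharp patch /
link / `n`-step instances, every `d`, `L ≥ 1`), `Barriers.IntrinsicTunnellingLaw` (v3.2–3.3: the
charge-free `SU(N)` / `U(N)` laws — sectors := connected components of the admissible region —
for small steps, single links, exposed link sets and slabs) and `Barriers.BlockTunnellingLaw`
(v3.3: gauge-fixed solid blocks).  PROVED: `Barriers.localMoveTunnellingLaw`,
`Barriers.intrinsicTunnellingLaw`, `Barriers.blockTunnellingLaw` (theory2 rows 76 / 84 / 88 over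
`Scaling/TunnellingLaws`, `FluxTunnelling`, `MetricTunnellingSectors`, `SpecialUnitaryLocalPaths`,
`ExposedPatchSectors*`, `GaugeFixedPatchSectors*`, `BoxPatchSectors`). -/
def S4_LocalMoveTunnellingLaws : Prop :=
  Barriers.LocalMoveTunnellingLaw ∧ Barriers.IntrinsicTunnellingLaw ∧ Barriers.BlockTunnellingLaw

/-- S4 holds. -/
theorem S4_LocalMoveTunnellingLaws_holds : S4_LocalMoveTunnellingLaws :=
  ⟨Barriers.localMoveTunnellingLaw, Barriers.intrinsicTunnellingLaw, Barriers.blockTunnellingLaw⟩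

/-- **S5 (THE EXPLICIT 2-d `U(1)` SINGLE-LINK TUNNELLING LAW, every volume).**  For every `L ≥ 2`,
`β ≥ 0`, base point `x₀`, link `e₀` and every Markov kernel `κ` on `U(1)^{E}` leaving the Wilson
measure `μ_{β,L} = wilsonMeasure u1Rep β` invariant whose steps change only the link `e₀`
(`(μ ⊗ κ)`-a.s.): `e^{−3/2}/(π max(1,β)) · z₁(β)³ · (μ_{β,L} ⊗ κ){Q ≠ Q'} ≤ 2e^{−2β}`, `Q` the
integer flux charge of the plane through `x₀` and `z₁(β) = ∫ e^{−β(1 − Re g)} dg` the one-plaquette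
partition function.  PROVED: `Theory2.Lattice.TwoDim.u1_tunnelling_single_link_all`
(`Scaling/FluxTunnellingU1AllVolumes.lean`, lean-1 GEN-5; even `L` with constant `1`:
`TwoDim.u1_tunnelling_single_link`). -/
def S5_U1SingleLinkTunnellingLaw : Prop :=
  ∀ (L : ℕ) [NeZero L], 2 ≤ L → ∀ (β : ℝ), 0 ≤ β → ∀ (x₀ : Site 2 L) (e₀ : Edge 2 L)
    (κ : Kernel (GaugeConfig 2 L Circle) (GaugeConfig 2 L Circle)) [IsMarkovKernel κ],
    κ.Invariant (wilsonMeasure (d := 2) (L := L) u1Rep β) →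
    (∀ᵐ q ∂((wilsonMeasure (d := 2) (L := L) u1Rep β) ⊗ₘ κ), ∀ e, e ≠ e₀ → q.1 e = q.2 e) →
    ENNReal.ofReal (Real.exp (-(3 / 2)) * (1 / Real.pi * (max 1 β)⁻¹)) * z1 u1Rep β ^ 3 *
        ((wilsonMeasure (d := 2) (L := L) u1Rep β) ⊗ₘ κ)
          {q | topCharge x₀ 0 1 q.1 ≠ topCharge x₀ 0 1 q.2} ≤
      2 * ENNReal.ofReal (Real.exp (-(2 * β)))

/-- S5 holds (`TwoDim.u1_tunnelling_single_link_all`). -/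
theorem S5_U1SingleLinkTunnellingLaw_holds : S5_U1SingleLinkTunnellingLaw :=
  fun _ _ hL _ hβ x₀ e₀ κ _ hinv hloc => TwoDim.u1_tunnelling_single_link_all hL hβ x₀ e₀ κ hinv hloc

/-- **S6 (THE SECTOR AUTOCOVARIANCE FLOOR OF EXACT LOCAL SAMPLERS).**  For every `L ≥ 2`, `β ≥ 0`,
base point `x₀`, every process `(Z_k)` of `U(1)^E`-valued random variables on any probability space
whose one-time marginals are all `μ_{β,L}` and whose consecutive states differ a.s. in at most one
(prescribed) link `e_k`, every set `S ⊆ ℝ` of charge values and every `n` with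
`P{Q(Z_0) ∈ S} = P{Q(Z_n) ∈ S} = a`:
`a(1 − a) − n·(2e^{−2β} / (e^{−3/2}/(π max(1,β)) · z₁(β)³)) ≤ P{Q(Z_0) ∈ S, Q(Z_n) ∈ S} − P{Q(Z_0) ∈ S}·P{Q(Z_n) ∈ S}`.
PROVED: `Theory2.Lattice.TwoDim.u1_sector_autocov_floor_all`
(`Scaling/FluxTunnellingU1AutocorrelationAll.lean`, lean-1 GEN-5). -/
def S6_U1SectorAutocovFloor : Prop :=
  ∀ (L : ℕ) [NeZero L], 2 ≤ L → ∀ (β : ℝ), 0 ≤ β → ∀ (x₀ : Site 2 L) (Ω : Type) [MeasurableSpace Ω]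
    (P : Measure Ω) [IsProbabilityMeasure P] (Z : ℕ → Ω → GaugeConfig 2 L Circle),
    (∀ k, Measurable (Z k)) → (∀ k, P.map (Z k) = wilsonMeasure (d := 2) (L := L) u1Rep β) →
    ∀ (e : ℕ → Edge 2 L), (∀ k, ∀ᵐ ω ∂P, ∀ e', e' ≠ e k → Z k ω e' = Z (k + 1) ω e') →
    ∀ (S : Set ℝ) (n : ℕ) (a : ℝ), P.real {ω | topCharge x₀ 0 1 (Z 0 ω) ∈ S} = a →
    P.real {ω | topCharge x₀ 0 1 (Z n ω) ∈ S} = a →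
    a * (1 - a) - n * (2 * (Real.exp (-(2 * β)) /
        (Real.exp (-(3 / 2)) * (1 / Real.pi * (max 1 β)⁻¹) * (z1 u1Rep β).toReal ^ 3))) ≤
      P.real {ω | topCharge x₀ 0 1 (Z 0 ω) ∈ S ∧ topCharge x₀ 0 1 (Z n ω) ∈ S} -
        P.real {ω | topCharge x₀ 0 1 (Z 0 ω) ∈ S} * P.real {ω | topCharge x₀ 0 1 (Z n ω) ∈ S}

/-- S6 holds (`TwoDim.u1_sector_autocov_floor_all`). -/
theorem S6_U1SectorAutocovFloor_holds : S6_U1SectorAutocovFloor :=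
  fun _ _ hL _ hβ x₀ _ _ P _ Z hZ hmarg e hloc S n _ h0 hn =>
    TwoDim.u1_sector_autocov_floor_all hL hβ x₀ P Z hZ hmarg e hloc S n h0 hn

/-- **S7 (THE `ε`-SECTORS ARE EXACTLY THE FLUX SECTORS, `d = 2` — THEORY-2 conjecture C8).**  For
every `L ≥ 1` and every `ε` (stated for `0 < ε < 2`, where `Thin L ε` is a proper open subset),
two `ε`-thin `U(1)` configurations on `(ℤ/L)²` (every plaquette within chordal distance `ε` of `1`)
with the same flux charge lie in the same connected component of `Thin L ε`; with the tree's
converse (`Flux.topCharge_eq_of_mem_connectedComponentIn`) the components of the thin set are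
exactly the level sets of the charge.  PROVED: `ThinSectors.thinComponentsEqFluxSectors`
(`Scaling/ThinSectorsConnected.lean`, theory2 item 110). -/
def S7_ThinComponentsEqFluxSectors : Prop :=
  ∀ (L : ℕ) [NeZero L], ThinSectors.ThinComponentsEqFluxSectors L

/-- S7 holds (`ThinSectors.thinComponentsEqFluxSectors`). -/
theorem S7_ThinComponentsEqFluxSectors_holds : S7_ThinComponentsEqFluxSectors :=
  fun L _ => ThinSectors.thinComponentsEqFluxSectors L

/-- **S8 (WHAT AN EXACT FLUX-INSERTION MOVE COSTS PER STEP, EXACTLY — conjectures C9″b and C9″c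
DECIDED).**  On the 2-d `U(1)` torus `(ℤ/L)²` with Wilson weight `e^{−βS}`:
(i) BLOCK kernel (`boxInsertionMH`, the `l`-block spread carrying one unit of flux on
`N = (l+1)² − 4` plaquettes, `M = L² − N` untouched; `2 ≤ l`, `l + 1 ≤ L`, every parity): its
per-step tunnelling probability `P_{β,l,L} = boxTunnelProb β l L` obeys, for every `ε > 0` and all
large `β`, `e^{−β(E+ε)} ≤ P_{β,l,L} ≤ e^{−β(E−ε)}` with `E = (boxHeight l L).toReal`, AND
`E = N(1 − cos(α_l/2)) + M(1 − cos(π/M))` (`α_l = boxAlpha l = 2π/N`) if `2N ≤ L²`, else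
`E = L²(1 − cos(2π/L²))`;
(ii) LINE kernel (`lineInsertionMH`, the wrapping-line twist, `N = L`, `M = L² − L`): for every
`L ≥ 4`, `(insHeight₂ (sliceTwist L) 0 0 1).toReal = L(1 − cos(π/L)) + (L² − L)(1 − cos(π/(L² − L)))`
and the same two-sided Laplace law holds for `(μ_β ⊗ K_line){Q ≠ Q'}` with that exponent.
PROVED: `Flux.u1_boxInsertion_height_law` (theory2 item 106b), `Flux.boxHeight_toReal_eq_ite`
(lean-1 GEN-6), `Flux.lineHeight_eq_sharp_four`, `Flux.u1_lineInsertion_fixedVolume_rate_four`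
(lean-1 GEN-7). -/
def S8_ExactInsertionSharpRates : Prop :=
  (∀ (l L : ℕ) [NeZero L], 2 ≤ l → l + 1 ≤ L →
    (∀ ε : ℝ, 0 < ε → ∀ᶠ β : ℝ in atTop,
      Real.exp (-(β * ((boxHeight l L).toReal + ε))) ≤ boxTunnelProb β l L ∧
        boxTunnelProb β l L ≤ Real.exp (-(β * ((boxHeight l L).toReal - ε)))) ∧
    (boxHeight l L).toReal =
      if 2 * ((l + 1) * (l + 1) - 4) ≤ L ^ 2 then
        (((l + 1) * (l + 1) - 4 : ℕ) : ℝ) * (1 - Real.cos (boxAlpha l / 2)) +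
          ((L ^ 2 - ((l + 1) * (l + 1) - 4) : ℕ) : ℝ) *
            (1 - Real.cos (Real.pi / ((L ^ 2 - ((l + 1) * (l + 1) - 4) : ℕ) : ℝ)))
      else (L : ℝ) ^ 2 * (1 - Real.cos (2 * Real.pi / (L : ℝ) ^ 2))) ∧
  (∀ (L : ℕ) [NeZero L], 4 ≤ L →
    (insHeight₂ (sliceTwist L) (0 : Site 2 L) 0 1).toReal =
      (L : ℝ) * (1 - Real.cos (Real.pi / L)) +
        ((L : ℝ) ^ 2 - L) * (1 - Real.cos (Real.pi / ((L : ℝ) ^ 2 - L))) ∧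
    ∀ ε : ℝ, 0 < ε → ∀ᶠ β : ℝ in atTop,
      Real.exp (-(β * ((L : ℝ) * (1 - Real.cos (Real.pi / L)) +
          ((L : ℝ) ^ 2 - L) * (1 - Real.cos (Real.pi / ((L : ℝ) ^ 2 - L))) + ε))) ≤
        ((wilsonMeasure (d := 2) (L := L) u1Rep β) ⊗ₘ lineInsertionMH (L := L) β).real
          {q | topCharge (0 : Site 2 L) 0 1 q.1 ≠ topCharge (0 : Site 2 L) 0 1 q.2} ∧
      ((wilsonMeasure (d := 2) (L := L) u1Rep β) ⊗ₘ lineInsertionMH (L := L) β).real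
          {q | topCharge (0 : Site 2 L) 0 1 q.1 ≠ topCharge (0 : Site 2 L) 0 1 q.2} ≤
        Real.exp (-(β * ((L : ℝ) * (1 - Real.cos (Real.pi / L)) +
          ((L : ℝ) ^ 2 - L) * (1 - Real.cos (Real.pi / ((L : ℝ) ^ 2 - L))) - ε))))

/-- S8 holds (`Flux.u1_boxInsertion_height_law`, `Flux.boxHeight_toReal_eq_ite`,
`Flux.lineHeight_eq_sharp_four`, `Flux.u1_lineInsertion_fixedVolume_rate_four`). -/
theorem S8_ExactInsertionSharpRates_holds : S8_ExactInsertionSharpRates :=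
  ⟨fun _ _ _ hl hlL =>
      ⟨fun _ hε => u1_boxInsertion_height_law hl hlL hε, boxHeight_toReal_eq_ite hl hlL⟩,
    fun _ _ hL =>
      ⟨lineHeight_eq_sharp_four hL, fun _ hε => u1_lineInsertion_fixedVolume_rate_four hL hε⟩⟩

/-- **The theory conjunction of record, extended by the topological-freezing laws**:
`TheoryStatementS8 := TheoryStatement ∧ S4 ∧ S5 ∧ S6 ∧ S7 ∧ S8`.  All conjuncts are theorems in
the tree (`TheoryStatementS8_holds`).  DRAFT: the operator's adoption defines the venture's
statement of record; nothing numerical is asserted. -/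
def TheoryStatementS8 : Prop :=
  TheoryStatement ∧ S4_LocalMoveTunnellingLaws ∧ S5_U1SingleLinkTunnellingLaw ∧
    S6_U1SectorAutocovFloor ∧ S7_ThinComponentsEqFluxSectors ∧ S8_ExactInsertionSharpRates

/-- The extended theory conjunction holds. -/
theorem TheoryStatementS8_holds : TheoryStatementS8 :=
  ⟨TheoryStatement_holds, S4_LocalMoveTunnellingLaws_holds, S5_U1SingleLinkTunnellingLaw_holds,
    S6_U1SectorAutocovFloor_holds, S7_ThinComponentsEqFluxSectors_holds,
    S8_ExactInsertionSharpRates_holds⟩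

end Summit.Ventures.LatticeQCDFlow

end
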